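import Literature.NumberTheory.Automorphic.SiegelReducedFamiliesSchur
import HarnessLib

/-!
# Siegel-reduced families are quasi-diagonal: lower bounds for the quadratic form

Topic `NumberTheory/Automorphic`; namespace `Literature.NumberTheory.Automorphic`, grouping
sub-namespace `SiegelFamily`.  Theorems only; sequel to `SiegelReducedFamilies`,
`SiegelReducedFamiliesQuadForm` (the real quadratic form `qf M y = re (yᴴ M y)`, `lastRe`) and
`SiegelReducedFamiliesSchur` (`qf_schur`).

A positive form `H = u Λ uᴴ` in a Siegel set of `GL_n` (unipotent coordinates bounded, successive
pivots `a_{i+1} < τ a_i`) is comparable with its diagonal of pivots: `κ⁻¹ Λ ≤ H ≤ κ Λ` with `κ`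
depending only on the Siegel constants ([Borel1969, §1, §4 (the "quasi-diagonal" comparison used
for the Siegel property), §12–§13]).  In the recursive vocabulary of `SiegelFamily.IsReduced c C τ m`
we prove the LOWER half in the form needed for reduction estimates in the cone:

* `SiegelFamily.exists_qf_lower_of_isReduced` — for `0 < τ` and every `m` there is `ε > 0`
  (depending on `m, c, τ` only) with `ε · a_w · Σ ‖x i‖² ≤ qf (H w) x` for every
  `(c, C, τ)`-reduced family `H` and every place `w`, `a_w = lastRe (H w)` the last pivot
  (induction on `m` through `qf H (z, s) = qf (schur H) z + a ‖s + β/a‖²`, `β = vᴴ z`,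
  `v` the last column, `‖v j‖ < c a`, and `a < τ ·` next pivot);
* `SiegelFamily.sum_norm_sq_le_mul_qf` — for a positive definite `H`,
  `Σ ‖y i‖² ≤ (1 + Σ ‖(H⁻¹) i j‖) · qf H y` (the smallest eigenvalue against the entries of the
  inverse, proved by evaluating `qf H ≥ 0` at `y − t H⁻¹ y`);
* `SiegelFamily.re_conj_apply_self` — `re (A H Aᴴ)[i,i] = qf H (star (A i))`.

## References

* A. Borel, *Introduction aux groupes arithmétiques*, Hermann (1969), §1, §4, §12–§13 [Borel1969].
* R. A. Horn, C. R. Johnson, *Matrix Analysis*, 2nd ed. (2013), §4.2, §7.7 — standard. [folklore]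
-/

noncomputable section

open scoped ComplexOrder Matrix ComplexConjugate
open Finset

namespace Literature.NumberTheory.Automorphic

namespace SiegelFamily

/-! ### Quadratic forms: conjugation and the smallest eigenvalue -/

section QuadForm

variable {n : Type*} [Fintype n]

/-- **Diagonal entries of `A H Aᴴ` are values of the quadratic form of `H`** at the conjugate rows
of `A`: `re (A H Aᴴ)[i,i] = qf H (star (A i))`. [folklore] -/
theorem re_conj_apply_self {p : Type*} (A : Matrix p n ℂ) (H : Matrix n n ℂ) (i : p) :
    ((A * H * Aᴴ) i i).re = qf H (star (A i)) := by
  have h : (A * H * Aᴴ) i i = star (star (A i)) ⬝ᵥ (H *ᵥ star (A i)) := by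
    rw [star_star]
    simp only [Matrix.mul_apply, Matrix.conjTranspose_apply, dotProduct, Matrix.mulVec,
      Pi.star_apply, Finset.sum_mul, Finset.mul_sum]
    rw [Finset.sum_comm]
    refine Finset.sum_congr rfl fun l _ => Finset.sum_congr rfl fun k _ => ?_
    ring
  rw [h]

/-- **The quadratic form of a positive definite matrix against the entries of the inverse**:
`Σ ‖y i‖² ≤ (1 + Σ ‖(H⁻¹) i j‖) · qf H y` (the quadratic form `qf H ≥ 0` at `y − t H⁻¹ y` with
`t = 1 / (1 + Σ ‖(H⁻¹) i j‖)`, and `qf H⁻¹ y ≤ (Σ ‖(H⁻¹) i j‖) Σ ‖y i‖²`). [folklore] -/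
theorem sum_norm_sq_le_mul_qf [DecidableEq n] {H : Matrix n n ℂ} (hH : H.PosDef) (y : n → ℂ) :
    ∑ i, ‖y i‖ ^ 2 ≤ (1 + ∑ i, ∑ j, ‖H⁻¹ i j‖) * qf H y := by
  set G : Matrix n n ℂ := H⁻¹ with hG
  set s : ℝ := ∑ i, ∑ j, ‖G i j‖ with hs
  set Y : ℝ := ∑ i, ‖y i‖ ^ 2 with hY
  have hs0 : 0 ≤ s := Finset.sum_nonneg fun _ _ => Finset.sum_nonneg fun _ _ => norm_nonneg _
  have hY0 : 0 ≤ Y := Finset.sum_nonneg fun _ _ => sq_nonneg _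
  have hE : 0 < 1 + s := by linarith
  set t : ℝ := (1 + s)⁻¹ with ht
  have ht0 : 0 < t := inv_pos.2 hE
  have hU : IsUnit H.det := (Matrix.isUnit_iff_isUnit_det _).mp hH.isUnit
  have hGpd : G.PosDef := hH.inv
  -- `qf G y ≤ s Y`
  have hGY : qf G y ≤ s * Y := by
    have h1 : qf G y ≤ ‖star y ⬝ᵥ (G *ᵥ y)‖ := Complex.re_le_norm _
    have h2 : ‖star y ⬝ᵥ (G *ᵥ y)‖ ≤ ∑ i, ∑ j, ‖y i‖ * ‖G i j‖ * ‖y j‖ := by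
      calc ‖star y ⬝ᵥ (G *ᵥ y)‖ = ‖∑ i, star (y i) * ∑ j, G i j * y j‖ := rfl
        _ ≤ ∑ i, ‖star (y i) * ∑ j, G i j * y j‖ := norm_sum_le _ _
        _ ≤ ∑ i, ∑ j, ‖y i‖ * ‖G i j‖ * ‖y j‖ := Finset.sum_le_sum fun i _ => by
            rw [norm_mul, norm_star]
            calc ‖y i‖ * ‖∑ j, G i j * y j‖ ≤ ‖y i‖ * ∑ j, ‖G i j‖ * ‖y j‖ :=
                  mul_le_mul_of_nonneg_left ((norm_sum_le _ _).trans
                    (le_of_eq (Finset.sum_congr rfl fun j _ => norm_mul _ _))) (norm_nonneg _)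
              _ = ∑ j, ‖y i‖ * ‖G i j‖ * ‖y j‖ := by
                  rw [Finset.mul_sum]
                  exact Finset.sum_congr rfl fun j _ => by ring
    have h3 : ∀ i j, ‖y i‖ * ‖G i j‖ * ‖y j‖ ≤ ‖G i j‖ * Y := fun i j => by
      have hi : ‖y i‖ ^ 2 ≤ Y :=
        Finset.single_le_sum (f := fun i => ‖y i‖ ^ 2) (fun _ _ => sq_nonneg _) (Finset.mem_univ i)
      have hj : ‖y j‖ ^ 2 ≤ Y :=
        Finset.single_le_sum (f := fun i => ‖y i‖ ^ 2) (fun _ _ => sq_nonneg _) (Finset.mem_univ j)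
      nlinarith [sq_nonneg (‖y i‖ - ‖y j‖), norm_nonneg (G i j), norm_nonneg (y i),
        norm_nonneg (y j), mul_nonneg (norm_nonneg (G i j)) (sq_nonneg (‖y i‖ - ‖y j‖))]
    calc qf G y ≤ ∑ i, ∑ j, ‖y i‖ * ‖G i j‖ * ‖y j‖ := h1.trans h2
      _ ≤ ∑ i, ∑ j, ‖G i j‖ * Y := Finset.sum_le_sum fun i _ => Finset.sum_le_sum fun j _ => h3 i j
      _ = s * Y := by rw [hs, Finset.sum_mul]; exact Finset.sum_congr rfl fun i _ => (Finset.sum_mul _ _ _).symm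
  -- the expansion of `qf H (y - t G y)`
  have hHG : H *ᵥ (G *ᵥ y) = y := by
    rw [Matrix.mulVec_mulVec, hG, Matrix.mul_nonsing_inv _ hU, Matrix.one_mulVec]
  have hyy : star y ⬝ᵥ y = (Y : ℂ) := by
    rw [hY, Complex.ofReal_sum]
    simp only [dotProduct, Pi.star_apply, Complex.star_def, Complex.conj_mul', Complex.ofReal_pow]
  have hGy_y : star (G *ᵥ y) ⬝ᵥ y = star y ⬝ᵥ (G *ᵥ y) := by
    rw [Matrix.star_mulVec, hGpd.1.eq, ← Matrix.dotProduct_mulVec]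
  have hGy_Hy : star (G *ᵥ y) ⬝ᵥ (H *ᵥ y) = (Y : ℂ) := by
    rw [Matrix.star_mulVec, hGpd.1.eq, ← Matrix.dotProduct_mulVec, Matrix.mulVec_mulVec, hG,
      Matrix.nonsing_inv_mul _ hU, Matrix.one_mulVec, hyy]
  have hexp : star (y - (t : ℂ) • (G *ᵥ y)) ⬝ᵥ (H *ᵥ (y - (t : ℂ) • (G *ᵥ y))) =
      star y ⬝ᵥ (H *ᵥ y) - 2 * (t : ℂ) * Y + (t : ℂ) ^ 2 * (star y ⬝ᵥ (G *ᵥ y)) := by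
    rw [Matrix.mulVec_sub, Matrix.mulVec_smul, hHG, star_sub, star_smul, sub_dotProduct,
      dotProduct_sub, dotProduct_sub, smul_dotProduct, smul_dotProduct, dotProduct_smul,
      dotProduct_smul, hyy, hGy_Hy, hGy_y, Complex.star_def, Complex.conj_ofReal]
    simp only [smul_eq_mul]
    ring
  have hq : 0 ≤ qf H (y - (t : ℂ) • (G *ᵥ y)) := qf_nonneg_of_posSemidef hH.posSemidef _
  have hq' : qf H (y - (t : ℂ) • (G *ᵥ y)) = qf H y - 2 * t * Y + t ^ 2 * qf G y := by
    rw [qf, hexp]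
    simp only [Complex.sub_re, Complex.add_re, Complex.mul_re, Complex.ofReal_re, Complex.ofReal_im,
      Complex.re_ofNat, Complex.im_ofNat, mul_zero, sub_zero]
    rw [← Complex.ofReal_pow, Complex.ofReal_re, Complex.ofReal_im]
    ring
  rw [hq'] at hq
  -- `t² qf G y ≤ t Y`
  have h4 : t ^ 2 * qf G y ≤ t * Y := by
    have h5 : t ^ 2 * qf G y ≤ t ^ 2 * (s * Y) := mul_le_mul_of_nonneg_left hGY (sq_nonneg _)
    have h6 : t ^ 2 * (s * Y) ≤ t ^ 2 * ((1 + s) * Y) := by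
      refine mul_le_mul_of_nonneg_left ?_ (sq_nonneg _)
      nlinarith
    have h7 : t ^ 2 * ((1 + s) * Y) = t * Y := by
      rw [ht]
      field_simp
    linarith
  have h8 : t * Y ≤ qf H y := by linarith
  calc Y = (1 + s) * (t * Y) := by rw [ht]; field_simp
    _ ≤ (1 + s) * qf H y := mul_le_mul_of_nonneg_left h8 hE.le

end QuadForm

/-! ### The lower quasi-diagonal bound for reduced families -/

section Reduced

variable {ι : Type*}

/-- **Reduced families are quasi-diagonal (lower bound).**  For `0 < τ` and every `m` there is
`ε > 0`, depending only on `m, c, τ`, such that for every `(c, C, τ)`-reduced family `H`, every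
index `w` and every vector `x`, `ε · lastRe (H w) · Σ ‖x i‖² ≤ qf (H w) x`: the form dominates
`ε` times its last pivot.  Induction on `m`: `qf H (z, s) = qf (schur H) z + a ‖s + β/a‖²`
(`β = vᴴ z`, `v` the last column, `a` the last pivot), `‖β‖ ≤ √m · c a ‖z‖`, and the next pivot
exceeds `a / τ`. [cite: Borel1969, §4 and §12–§13] -/
theorem exists_qf_lower_of_isReduced (c C τ : ℝ) (hτ : 0 < τ) :
    ∀ m : ℕ, ∃ ε : ℝ, 0 < ε ∧ ∀ (H : ι → Matrix (Fin m) (Fin m) ℂ), IsReduced c C τ m H →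
      ∀ (w : ι) (x : Fin m → ℂ), ε * lastRe (H w) * ∑ i, ‖x i‖ ^ 2 ≤ qf (H w) x
  | 0 => ⟨1, one_pos, fun H _ w x => by simp [qf, dotProduct]⟩
  | m + 1 => by
    obtain ⟨ε, hε, hq⟩ := exists_qf_lower_of_isReduced c C τ hτ m
    -- constants
    set ε' : ℝ := min 1 (ε / τ) with hε'
    have hε'0 : 0 < ε' := lt_min one_pos (div_pos hε hτ)
    have hε'1 : ε' ≤ 1 := min_le_left _ _
    have hε'2 : ε' ≤ ε / τ := min_le_right _ _
    have hden : 0 < c ^ 2 * m + 1 := by positivity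
    set θ : ℝ := ε' / (c ^ 2 * m + 1) with hθ
    have hθ0 : 0 < θ := div_pos hε'0 hden
    have hθε : θ * (c ^ 2 * m + 1) = ε' := div_mul_cancel₀ _ hden.ne'
    have hθ1 : θ ≤ 1 := by
      have : θ ≤ ε' := div_le_self hε'0.le (by nlinarith [sq_nonneg c])
      exact this.trans hε'1
    refine ⟨θ / 2, by positivity, fun H hH w x => ?_⟩
    obtain ⟨hherm, hpos, -, hcol, hratio, hsch⟩ := hH
    -- split `x = (z, s)`
    set z : Fin m → ℂ := fun j => x j.castSucc with hz
    set s : ℂ := x (Fin.last m) with hs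
    have hx : x = Fin.snoc z s := by
      funext i
      refine Fin.lastCases ?_ (fun j => ?_) i
      · simp [hs]
      · simp [hz]
    set a : ℝ := (H w (Fin.last m) (Fin.last m)).re with ha
    have ha0 : 0 < a := hpos w
    set β : ℂ := star (lastCol (H w)) ⬝ᵥ z with hβ
    set Z : ℝ := ∑ j, ‖z j‖ ^ 2 with hZ
    have hZ0 : 0 ≤ Z := Finset.sum_nonneg fun _ _ => sq_nonneg _
    have hsumx : ∑ i, ‖x i‖ ^ 2 = Z + ‖s‖ ^ 2 := by
      rw [Fin.sum_univ_castSucc]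
    have hlast : lastRe (H w) = a := rfl
    -- the two expansions
    have h1 : qf (H w) x = qf (topLeft (H w)) z + 2 * (conj s * β).re + a * ‖s‖ ^ 2 := by
      rw [hx]
      exact qf_snoc (hherm w) z s
    have h2 : qf (schur H w) z = qf (topLeft (H w)) z - ‖β‖ ^ 2 / a := qf_schur w (hherm w) z
    -- induction hypothesis on the Schur complement: `ε' a Z ≤ qf (schur H w) z`
    have h3 : ε' * a * Z ≤ qf (schur H w) z := by
      cases m with
      | zero =>
        have hZ' : Z = 0 := Finset.sum_eq_zero fun j _ => Fin.elim0 j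
        have hq0 : qf (schur H w) z = 0 := by simp [qf, dotProduct]
        rw [hZ', hq0, mul_zero]
      | succ k =>
        have hIH := hq (schur H) hsch w z
        rw [lastRe_succ] at hIH
        have hr := hratio w (Fin.last k) (by simp)
        have hdiv : a / τ ≤ (schur H w (Fin.last k) (Fin.last k)).re := by
          rw [div_le_iff₀ hτ]
          linarith [mul_comm τ (schur H w (Fin.last k) (Fin.last k)).re]
        calc ε' * a * Z ≤ ε / τ * a * Z :=
              mul_le_mul_of_nonneg_right (mul_le_mul_of_nonneg_right hε'2 ha0.le) hZ0
          _ = ε * (a / τ) * Z := by ring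
          _ ≤ ε * (schur H w (Fin.last k) (Fin.last k)).re * Z :=
              mul_le_mul_of_nonneg_right (mul_le_mul_of_nonneg_left hdiv hε.le) hZ0
          _ ≤ qf (schur H w) z := hIH
    -- Cauchy–Schwarz: `‖β‖² ≤ m (c a)² Z`
    have h4 : ‖β‖ ^ 2 ≤ m * (c * a) ^ 2 * Z := by
      have hcs := norm_star_dotProduct_sq_le (lastCol (H w)) z
      have hcol2 : ∑ j, ‖lastCol (H w) j‖ ^ 2 ≤ m * (c * a) ^ 2 := by
        calc ∑ j, ‖lastCol (H w) j‖ ^ 2 ≤ ∑ _j : Fin m, (c * a) ^ 2 :=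
              Finset.sum_le_sum fun j _ => pow_le_pow_left₀ (norm_nonneg _) (hcol w j).le 2
          _ = m * (c * a) ^ 2 := by simp
      exact hcs.trans (mul_le_mul_of_nonneg_right hcol2 hZ0)
    -- the mixed term
    have h5 : -(2 * (‖s‖ * ‖β‖)) ≤ 2 * (conj s * β).re := by
      have h := Complex.abs_re_le_norm (conj s * β)
      rw [norm_mul, Complex.norm_conj] at h
      linarith [neg_abs_le (conj s * β).re]
    -- assemble: `qf ≥ ε' a Z + a (t - u)²` with `t = ‖s‖`, `u = ‖β‖ / a`
    set t : ℝ := ‖s‖ with ht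
    set u : ℝ := ‖β‖ / a with hu
    have ht0 : 0 ≤ t := norm_nonneg _
    have hkey : ‖β‖ ^ 2 / a - 2 * (t * ‖β‖) + a * t ^ 2 = a * (t - u) ^ 2 := by
      rw [hu]
      field_simp
      ring
    have hu2 : u ^ 2 ≤ m * c ^ 2 * Z := by
      rw [hu, div_pow, div_le_iff₀ (pow_pos ha0 2)]
      nlinarith [h4]
    have hlow : ε' * a * Z + a * (t - u) ^ 2 ≤ qf (H w) x := by
      rw [h1, ← hkey]
      linarith [h2, h3, h5]
    -- `(t - u)² ≥ θ (t²/2 - u²)`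
    have h6 : θ * (t ^ 2 / 2 - u ^ 2) ≤ (t - u) ^ 2 := by
      nlinarith [mul_nonneg (sub_nonneg.2 hθ1) (sq_nonneg (t - u)),
        mul_nonneg hθ0.le (sq_nonneg (t - 2 * u))]
    have h7 : a * (θ * (t ^ 2 / 2 - u ^ 2)) ≤ a * (t - u) ^ 2 := mul_le_mul_of_nonneg_left h6 ha0.le
    have h8 : θ * u ^ 2 ≤ θ * (m * c ^ 2 * Z) := mul_le_mul_of_nonneg_left hu2 hθ0.le
    rw [hlast, hsumx]
    nlinarith [h7, h8, hlow, hθε, mul_nonneg ha0.le hZ0, mul_nonneg (mul_nonneg hθ0.le ha0.le) hZ0]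

end Reduced

end SiegelFamily

end Literature.NumberTheory.Automorphic
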